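import Literature.NumberTheory.LFunctions.AlternativeHypothesis
import Literature.NumberTheory.LFunctions.MontgomeryZeroWindows
import Literature.NumberTheory.LFunctions.SelbergFujiiLargeGaps
import HarnessLib

/-!
# `p_0 = 1` implies the Essential Simplicity Hypothesis (BGSTB 2025, after Theorem 2) — proved

Topic `Literature/NumberTheory/LFunctions` (namespace `Literature.NumberTheory.LFunctions`). PROOF
LAYER (no new facts), cell `rh-crit/ah` (C5, t5). LABEL: **NOT RH-BEARING** — an unconditional
counting lemma about the ordinates of the zeros of `ζ`; nothing here bears on the truth of RH or of
AH.

Baluyot–Goldston–Suriajaya–Turnage-Butterbaugh 2025, §1: "We expect that `p_0 = 1`, which under RH,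
is a reformulation of the following conjecture [ESH]", and Theorem 2: "Assume that the Riemann
Hypothesis and the Strong AH-Pairs hold. Then `p_0 = lim_{T→∞} P_0 = 1`, and thus the Essential
Simplicity Hypothesis is true." The typed claim `bgstb2025_theorem2` (`AlternativeHypothesis.lean`)
stops at `p_0 = 1` (`AH.HasLimitingDensity 0 δ 1`); this file PROVES the step "and thus ESH" for the
tree's ordinate-language `EssentialSimplicityHypothesis` (Mueller 1983 / Ivić 2002 pair-count form),
WITHOUT RH: `essentialSimplicity_of_hasLimitingDensity_one`, and hence
`essentialSimplicity_of_theorem2 : bgstb2025_theorem2 → RiemannHypothesis → StrongAHPairs →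
EssentialSimplicityHypothesis`.

## The argument (elementary, from the tree's proved zero-counting results)

Fix `δ > 0` with `P_0(T) = |B_0(T, δ/2, δ)| / ((T/2π) log T) → 1` and let `α = δ/4`. A pair of
ordinates `0 < γ, γ' ≤ T` with `|γ − γ'| ≤ 2πα/log T`
* either has both members `> L := T/log²T`, and then lies in the diagonal bin `B_0(T, δ/2, δ)`
  (its normalised difference is `≤ δ/4 < δ/2` in absolute value); these are
  `≤ P_0(T) · (T/2π) log T ≤ (1 + ε/2)(T/2π) log T` in number for large `T`;
* or has a member `≤ L`, hence both members `≤ L + 1` (for `2πα ≤ log T`); for each of the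
  `≤ N(L + 1)` first members there are `≤ 3 C₀ log(T + 4)` second members within distance `1`
  (unit-window bound `N(u + 1) − N(u) ≤ C₀ log(|u| + 2)`, `Montgomery.exists_zetaZeroCount_window_le`,
  proved in the tree from the Riemann–von Mangoldt formula), and `N(L + 1) ≤ C (L + 1) log(L + 1)`
  (`AH.exists_zetaZeroCount_le_mul_log`, from the tree's `SelbergFujii.exists_abs_zetaZeroCount_sub_le`),
  so these are `O(T)`.
Since `N(T) ≥ (T/2π) log T − C₂ T` (Riemann–von Mangoldt again), the total is `≤ (1 + ε) N(T)` once
`log T ≫ 1/ε`. No hypothesis on the zeros beyond the limiting density is used.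

## References

* [BaluyotGoldstonSuriajayaTurnageButterbaugh2025] §1 (ESH), Theorem 2 ("and thus the Essential
  Simplicity Hypothesis is true").
* [Ivic2002SmallValues] (32)–(33); [Mueller1983] (the ESH); [Titchmarsh1986] Thm. 9.2/9.4 (the
  zero-counting inputs, proved in the tree: `riemann_von_mangoldt_holds`).
-/

noncomputable section

open Filter Set Finset
open scoped Real Topology Classical

namespace Literature.NumberTheory.LFunctions

namespace AH

/-- Local count: for `a ≥ 0`, the number of indices `j` in any finite set with `|a − γ_j| ≤ 1` is at
most `3 C₀ log(a + 4)`, given the unit-window bound `N(u+1) − N(u) ≤ C₀ log(|u| + 2)` (three unit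
windows cover `[a − 1, a + 1]`; Titchmarsh Thm. 9.2). [cite: Titchmarsh1986, Thm. 9.2] -/
theorem card_filter_abs_sub_le_one_le {C₀ : ℝ} (hC₀ : 0 ≤ C₀)
    (hW : ∀ u : ℝ, (zetaZeroCount (u + 1) : ℝ) - zetaZeroCount u ≤ C₀ * Real.log (|u| + 2))
    (s : Finset ℕ) {a : ℝ} (ha : 0 ≤ a) :
    ((s.filter fun j ↦ |a - zetaOrdinate j| ≤ 1).card : ℝ) ≤ 3 * C₀ * Real.log (a + 4) := by
  have hsub : (s.filter fun j ↦ |a - zetaOrdinate j| ≤ 1) ⊆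
      ((s.filter fun n ↦ a - 2 < zetaOrdinate n ∧ zetaOrdinate n ≤ a - 2 + 1) ∪
        (s.filter fun n ↦ a - 1 < zetaOrdinate n ∧ zetaOrdinate n ≤ a - 1 + 1)) ∪
        (s.filter fun n ↦ a < zetaOrdinate n ∧ zetaOrdinate n ≤ a + 1) := by
    intro j hj
    simp only [Finset.mem_union, Finset.mem_filter] at hj ⊢
    obtain ⟨hjs, hj⟩ := hj
    obtain ⟨h1, h2⟩ := abs_le.mp hj
    by_cases hA : zetaOrdinate j ≤ a - 1
    · exact Or.inl (Or.inl ⟨hjs, by linarith, by linarith⟩)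
    · by_cases hB : zetaOrdinate j ≤ a
      · exact Or.inl (Or.inr ⟨hjs, by push Not at hA; linarith, by linarith⟩)
      · exact Or.inr ⟨hjs, by push Not at hB; exact hB, by linarith⟩
  have hlogmono : ∀ u : ℝ, |u| + 2 ≤ a + 4 → C₀ * Real.log (|u| + 2) ≤ C₀ * Real.log (a + 4) :=
    fun u hu ↦ mul_le_mul_of_nonneg_left
      (Real.log_le_log (by linarith [abs_nonneg u]) hu) hC₀
  have h1 := (Montgomery.card_filter_window_le s (a - 2)).trans
    ((hW (a - 2)).trans (hlogmono _ (by
      have : |a - 2| ≤ a + 2 := abs_le.mpr ⟨by linarith, by linarith⟩; linarith)))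
  have h2 := (Montgomery.card_filter_window_le s (a - 1)).trans
    ((hW (a - 1)).trans (hlogmono _ (by
      have : |a - 1| ≤ a + 1 := abs_le.mpr ⟨by linarith, by linarith⟩; linarith)))
  have h3 := (Montgomery.card_filter_window_le s a).trans
    ((hW a).trans (hlogmono _ (by rw [abs_of_nonneg ha]; linarith)))
  have hcard := (Finset.card_le_card hsub).trans
    ((Finset.card_union_le _ _).trans (Nat.add_le_add_right (Finset.card_union_le _ _) _))
  have hcast : ((s.filter fun j ↦ |a - zetaOrdinate j| ≤ 1).card : ℝ) ≤
      ((s.filter fun n ↦ a - 2 < zetaOrdinate n ∧ zetaOrdinate n ≤ a - 2 + 1).card : ℝ) +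
        ((s.filter fun n ↦ a - 1 < zetaOrdinate n ∧ zetaOrdinate n ≤ a - 1 + 1).card : ℝ) +
        ((s.filter fun n ↦ a < zetaOrdinate n ∧ zetaOrdinate n ≤ a + 1).card : ℝ) := by
    exact_mod_cast hcard
  linarith

/-- Indices in `zeroIndexSet T` have `γ_i ≤ T` (`n < N(T) ↔ γ_n ≤ T`, Titchmarsh §9.1). [cite: Titchmarsh1986, §9.1] -/
theorem zetaOrdinate_le_of_mem_zeroIndexSet {T : ℝ} {i : ℕ} (hi : i ∈ zeroIndexSet T) :
    zetaOrdinate i ≤ T :=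
  Montgomery.zetaOrdinate_le_iff_lt.mpr (Finset.mem_range.mp hi)

/-- `#{i ∈ zeroIndexSet T : γ_i ≤ u} ≤ N(u)` (Titchmarsh §9.1). [cite: Titchmarsh1986, §9.1] -/
theorem card_filter_zetaOrdinate_le_le (T u : ℝ) :
    ((zeroIndexSet T).filter fun i ↦ zetaOrdinate i ≤ u).card ≤ zetaZeroCount u := by
  calc ((zeroIndexSet T).filter fun i ↦ zetaOrdinate i ≤ u).card
      ≤ (Finset.range (zetaZeroCount u)).card := by
        refine Finset.card_le_card fun i hi ↦ ?_
        rw [Finset.mem_filter] at hi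
        exact Finset.mem_range.mpr (Montgomery.zetaOrdinate_le_iff_lt.mp hi.2)
    _ = zetaZeroCount u := Finset.card_range _

/-- Off-window close pairs: a set `A` of pairs of indices of zeros `0 < γ, γ' ≤ T` in which every
pair has `|γ − γ'| ≤ 1` and at least one member `≤ L` has at most `N(L + 1) · 3C₀ log(T + 4)`
elements (each such pair has its first member `≤ L + 1`, and for each first member there are at most
`3C₀ log(T + 4)` partners within distance `1`; BGSTB 2025, §3, the estimate (zeropairbound) in this
crude form). [cite: BaluyotGoldstonSuriajayaTurnageButterbaugh2025, §3 (zeropairbound)] -/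
theorem card_pairs_offWindow_le {C₀ : ℝ} (hC₀ : 0 ≤ C₀)
    (hW : ∀ u : ℝ, (zetaZeroCount (u + 1) : ℝ) - zetaZeroCount u ≤ C₀ * Real.log (|u| + 2))
    {T L : ℝ} (hT : 0 ≤ T) {A : Finset (ℕ × ℕ)} (hA : A ⊆ zeroIndexSet T ×ˢ zeroIndexSet T)
    (hclose : ∀ p ∈ A, |zetaOrdinate p.1 - zetaOrdinate p.2| ≤ 1)
    (hoff : ∀ p ∈ A, zetaOrdinate p.1 ≤ L ∨ zetaOrdinate p.2 ≤ L) :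
    (A.card : ℝ) ≤ zetaZeroCount (L + 1) * (3 * C₀ * Real.log (T + 4)) := by
  set S := zeroIndexSet T with hS
  set E : Finset (ℕ × ℕ) := (S.filter fun i ↦ zetaOrdinate i ≤ L + 1).biUnion fun i ↦
      (S.filter fun j ↦ |zetaOrdinate i - zetaOrdinate j| ≤ 1).image fun j ↦ (i, j) with hE
  have hsub : A ⊆ E := by
    intro p hp
    have hpS := Finset.mem_product.mp (hA hp)
    have hc := hclose p hp
    have h1 : zetaOrdinate p.1 ≤ L + 1 := by
      rcases hoff p hp with h | h
      · linarith
      · linarith [(abs_le.mp hc).2]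
    rw [hE, Finset.mem_biUnion]
    refine ⟨p.1, Finset.mem_filter.mpr ⟨hpS.1, h1⟩, ?_⟩
    rw [Finset.mem_image]
    exact ⟨p.2, Finset.mem_filter.mpr ⟨hpS.2, hc⟩, rfl⟩
  have hlogT : ∀ i ∈ S.filter (fun i ↦ zetaOrdinate i ≤ L + 1),
      ((S.filter fun j ↦ |zetaOrdinate i - zetaOrdinate j| ≤ 1).card : ℝ) ≤
        3 * C₀ * Real.log (T + 4) := by
    intro i hi
    have hiS := (Finset.mem_filter.mp hi).1
    have hγ0 : 0 ≤ zetaOrdinate i := (zetaOrdinate_pos_holds i).le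
    have hγT : zetaOrdinate i ≤ T := zetaOrdinate_le_of_mem_zeroIndexSet hiS
    calc ((S.filter fun j ↦ |zetaOrdinate i - zetaOrdinate j| ≤ 1).card : ℝ)
        ≤ 3 * C₀ * Real.log (zetaOrdinate i + 4) := card_filter_abs_sub_le_one_le hC₀ hW S hγ0
      _ ≤ 3 * C₀ * Real.log (T + 4) := by
          gcongr
  calc (A.card : ℝ) ≤ E.card := by exact_mod_cast Finset.card_le_card hsub
    _ ≤ ∑ i ∈ S.filter (fun i ↦ zetaOrdinate i ≤ L + 1),
          (((S.filter fun j ↦ |zetaOrdinate i - zetaOrdinate j| ≤ 1).image fun j ↦ (i, j)).card : ℝ) := by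
        rw [hE]
        exact_mod_cast Finset.card_biUnion_le
    _ ≤ ∑ i ∈ S.filter (fun i ↦ zetaOrdinate i ≤ L + 1),
          ((S.filter fun j ↦ |zetaOrdinate i - zetaOrdinate j| ≤ 1).card : ℝ) := by
        gcongr with i hi
        exact_mod_cast Finset.card_image_le
    _ ≤ ∑ i ∈ S.filter (fun i ↦ zetaOrdinate i ≤ L + 1), 3 * C₀ * Real.log (T + 4) :=
        Finset.sum_le_sum hlogT
    _ = ((S.filter fun i ↦ zetaOrdinate i ≤ L + 1).card : ℝ) * (3 * C₀ * Real.log (T + 4)) := by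
        rw [Finset.sum_const, nsmul_eq_mul]
    _ ≤ zetaZeroCount (L + 1) * (3 * C₀ * Real.log (T + 4)) := by
        have hT4 : 0 ≤ 3 * C₀ * Real.log (T + 4) := by
          have := Real.log_nonneg (show (1 : ℝ) ≤ T + 4 by linarith)
          positivity
        gcongr
        exact_mod_cast card_filter_zetaOrdinate_le_le T (L + 1)

/-- Growth of `N`: `N(u) ≤ C u log u` for `u ≥ 2` (from the Riemann–von Mangoldt formula,
Titchmarsh Thm. 9.4, proved in the tree). [cite: Titchmarsh1986, Thm. 9.4] -/
theorem exists_zetaZeroCount_le_mul_log :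
    ∃ C : ℝ, 0 < C ∧ ∀ u : ℝ, 2 ≤ u → (zetaZeroCount u : ℝ) ≤ C * (u * Real.log u) := by
  obtain ⟨K₀, hK₀, T₀, hT₀, h⟩ := SelbergFujii.exists_abs_zetaZeroCount_sub_le
  set u₀ : ℝ := max T₀ 3 with hu₀
  refine ⟨1 + K₀ + zetaZeroCount u₀, by positivity, fun u hu ↦ ?_⟩
  have hlog2 : (1 : ℝ) ≤ u * Real.log u := by
    have h2 : Real.log 2 ≤ Real.log u := Real.log_le_log (by norm_num) hu
    nlinarith [Real.log_two_gt_d9]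
  have hulog : 0 ≤ u * Real.log u := by linarith
  rcases le_or_gt u₀ u with hcase | hcase
  · have hT : T₀ ≤ u := (le_max_left _ _).trans hcase
    have hu1 : 1 ≤ u := by linarith
    have hupos : 0 < u := by linarith
    have hb := (abs_le.mp (h u hT)).2
    have hlogu : 0 ≤ Real.log u := Real.log_nonneg hu1
    have hmain : u / (2 * π) * Real.log (u / (2 * π)) - u / (2 * π) ≤ u * Real.log u := by
      have hπ : 1 ≤ 2 * π := by linarith [Real.pi_gt_three]
      have h1 : Real.log (u / (2 * π)) ≤ Real.log u :=
        Real.log_le_log (by positivity) (div_le_self hupos.le hπ)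
      have h2 : u / (2 * π) ≤ u := div_le_self hupos.le hπ
      have h3 : 0 ≤ u / (2 * π) := by positivity
      nlinarith
    have hK : K₀ * Real.log u ≤ K₀ * (u * Real.log u) := by
      gcongr
      nlinarith
    have hN0 : (0 : ℝ) ≤ zetaZeroCount u₀ * (u * Real.log u) := by positivity
    nlinarith
  · have hmono : (zetaZeroCount u : ℝ) ≤ zetaZeroCount u₀ := by
      exact_mod_cast zetaZeroCount_mono hcase.le
    have hpos : 0 ≤ (1 + K₀) * (u * Real.log u) := by positivity
    nlinarith

/-- Lower bound: `N(T) ≥ (T/2π) log T − C₂ T` for all large `T` (Riemann–von Mangoldt formula,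
Titchmarsh Thm. 9.4, proved in the tree). [cite: Titchmarsh1986, Thm. 9.4] -/
theorem exists_zetaZeroCount_ge_sub :
    ∃ C₂ T₀ : ℝ, 0 ≤ C₂ ∧ ∀ T : ℝ, T₀ ≤ T →
      T / (2 * π) * Real.log T - C₂ * T ≤ (zetaZeroCount T : ℝ) := by
  obtain ⟨K₀, hK₀, T₀, hT₀, h⟩ := SelbergFujii.exists_abs_zetaZeroCount_sub_le
  have hπ : 1 ≤ 2 * π := by linarith [Real.pi_gt_three]
  have hl2π : 0 ≤ Real.log (2 * π) := Real.log_nonneg hπ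
  refine ⟨(Real.log (2 * π) + 1) / (2 * π) + K₀, T₀, by positivity, fun T hT ↦ ?_⟩
  have hT1 : 1 ≤ T := hT₀.trans hT
  have hTpos : 0 < T := by linarith
  have hb := (abs_le.mp (h T hT)).1
  have hlogT : Real.log T ≤ T := by linarith [Real.log_le_sub_one_of_pos hTpos]
  have hlogT0 : 0 ≤ Real.log T := Real.log_nonneg hT1
  rw [Real.log_div hTpos.ne' (by positivity)] at hb
  have : K₀ * Real.log T ≤ K₀ * T := by gcongr
  have e : T / (2 * π) * (Real.log T - Real.log (2 * π)) - T / (2 * π) =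
      T / (2 * π) * Real.log T - (Real.log (2 * π) + 1) / (2 * π) * T := by ring
  nlinarith

end AH

/-- **`p_0 = 1` implies the Essential Simplicity Hypothesis** (the direction BGSTB 2025 invoke
after Theorem 2: "`p_0 = lim_{T→∞} P_0 = 1`, and thus the Essential Simplicity Hypothesis is true"),
for the tree's ordinate-language `EssentialSimplicityHypothesis` and UNCONDITIONALLY given the
limiting density (no RH): if `P_0(T) → 1` for some bin half-width `δ > 0`, then for `α = δ/4` the
pairs `0 < γ, γ' ≤ T` with `|γ − γ'| ≤ 2πα/log T` number at most `(1 + ε) N(T)` for all large `T`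
— those with both members `> T/log²T` lie in `B_0`, the others are `O(T)` by the local density of
zeros (`N(u+1) − N(u) ≪ log(|u|+2)`, tree) and `N(T/log²T + 1) ≪ T/log T`, while
`N(T) = (T/2π) log T + O(T)` (Riemann–von Mangoldt, tree). [cite: BaluyotGoldstonSuriajayaTurnageButterbaugh2025, Theorem 2 ("and thus ESH")] -/
theorem essentialSimplicity_of_hasLimitingDensity_one {δ : ℝ} (hδ : 0 < δ)
    (h : AH.HasLimitingDensity 0 δ 1) : EssentialSimplicityHypothesis := by
  intro ε hε
  refine ⟨δ / 4, by positivity, ?_⟩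
  -- constants
  obtain ⟨C₀, hC₀, hW⟩ := Montgomery.exists_zetaZeroCount_window_le
  obtain ⟨CN, hCN, hN⟩ := AH.exists_zetaZeroCount_le_mul_log
  obtain ⟨C₂, T₂, hC₂, hlow⟩ := AH.exists_zetaZeroCount_ge_sub
  set C₃ : ℝ := 12 * CN * C₀ with hC₃
  -- the limiting density at the level `M = δ/2`
  have hP : Tendsto (fun T : ℝ ↦ AH.binDensity 0 T (δ / 2) δ) atTop (𝓝 1) := by
    have := AH.hasLimitingDensity_iff.mp h
    simpa using this
  have ev1 : ∀ᶠ T : ℝ in atTop, AH.binDensity 0 T (δ / 2) δ ≤ 1 + ε / 2 :=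
    hP.eventually_le_const (by linarith)
  have ev2 : ∀ᶠ T : ℝ in atTop, 2 * π * (δ / 4) ≤ Real.log T :=
    Real.tendsto_log_atTop.eventually_ge_atTop _
  have ev3 : ∀ᶠ T : ℝ in atTop, Real.log T ^ 2 / (1 * T + 0) ≤ 1 / 2 :=
    (Real.tendsto_pow_log_div_mul_add_atTop 1 0 2 one_ne_zero).eventually_le_const (by norm_num)
  have ev4 : ∀ᶠ T : ℝ in atTop, max T₂ 8 ≤ T := eventually_ge_atTop _
  have ev5 : ∀ᶠ T : ℝ in atTop, 4 * π * (C₃ + (1 + ε) * C₂) / ε ≤ Real.log T :=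
    Real.tendsto_log_atTop.eventually_ge_atTop _
  filter_upwards [ev1, ev2, ev3, ev4, ev5] with T h1 h2 h3 h4 h5
  have hT8 : 8 ≤ T := (le_max_right _ _).trans h4
  have hT2 : T₂ ≤ T := (le_max_left _ _).trans h4
  have hTpos : 0 < T := by linarith
  have hlogT : 2 ≤ Real.log T := by
    have : Real.log 8 = 3 * Real.log 2 := by
      rw [show (8 : ℝ) = 2 ^ 3 by norm_num, Real.log_pow]; norm_num
    have h8 : Real.log 8 ≤ Real.log T := Real.log_le_log (by norm_num) hT8
    linarith [Real.log_two_gt_d9]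
  have hlogpos : 0 < Real.log T := by linarith
  -- the window threshold `L = T / log² T`, with `2 ≤ L` and `L + 1 ≤ T`
  set L : ℝ := T / Real.log T ^ 2 with hL
  have hL2 : 2 * Real.log T ^ 2 ≤ T := by
    rw [one_mul, add_zero, div_le_iff₀ hTpos] at h3
    linarith
  have hLge : 2 ≤ L := by
    rw [hL, le_div_iff₀ (by positivity)]
    linarith
  have hL1T : L + 1 ≤ T := by
    have : L ≤ T / 2 := by
      rw [hL]
      exact div_le_div_of_nonneg_left hTpos.le (by norm_num) (by nlinarith)
    linarith
  -- split the pair count along "both ordinates > L"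
  set S := zeroIndexSet T with hS
  set close : ℕ × ℕ → Prop := fun p ↦
    2 * π * -(δ / 4) / Real.log T ≤ zetaOrdinate p.1 - zetaOrdinate p.2 ∧
      zetaOrdinate p.1 - zetaOrdinate p.2 ≤ 2 * π * (δ / 4) / Real.log T with hclose
  set win : ℕ × ℕ → Prop := fun p ↦ L < zetaOrdinate p.1 ∧ L < zetaOrdinate p.2 with hwin
  have hcount : (pairCorrelationCount (-(δ / 4)) (δ / 4) T : ℝ) =
      (((S ×ˢ S).filter close).filter win).card +
        (((S ×ˢ S).filter close).filter (fun p ↦ ¬ win p)).card := by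
    rw [← Nat.cast_add, Finset.card_filter_add_card_filter_not]
    simp [pairCorrelationCount, hS, hclose]
  -- (I) window pairs lie in the diagonal bin at level `M = δ/2`
  have hI : ((((S ×ˢ S).filter close).filter win).card : ℝ) ≤
      AH.binDensity 0 T (δ / 2) δ * (T / (2 * π) * Real.log T) := by
    have hsub : ((S ×ˢ S).filter close).filter win ⊆ AH.bin 0 T (δ / 2) δ := by
      intro p hp
      simp only [Finset.mem_filter, hclose, hwin] at hp
      obtain ⟨⟨hpS, hc1, hc2⟩, hw1, hw2⟩ := hp
      have hx1 : AH.pairSpacing T p ≤ δ / 4 := by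
        unfold AH.pairSpacing
        rw [div_le_iff₀ (by positivity)]
        have := (le_div_iff₀ hlogpos).mp hc2
        linarith
      have hx2 : -(δ / 4) ≤ AH.pairSpacing T p := by
        unfold AH.pairSpacing
        rw [le_div_iff₀ (by positivity)]
        have := (div_le_iff₀ hlogpos).mp hc1
        linarith
      rw [AH.mem_bin, AH.mem_pairs]
      refine ⟨⟨hpS, ?_, ?_, ?_⟩, ?_, ?_⟩
      · exact hw1
      · exact hw2
      · rw [abs_le]; constructor <;> linarith
      · push_cast; linarith
      · push_cast; linarith
    have hcard : ((((S ×ˢ S).filter close).filter win).card : ℝ) ≤ (AH.bin 0 T (δ / 2) δ).card := by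
      exact_mod_cast Finset.card_le_card hsub
    have hden : ((AH.bin 0 T (δ / 2) δ).card : ℝ) =
        AH.binDensity 0 T (δ / 2) δ * (T / (2 * π) * Real.log T) := by
      rw [AH.binDensity, div_mul_cancel₀]
      positivity
    linarith
  -- (II) off-window pairs are `O(T)`
  have hII : ((((S ×ˢ S).filter close).filter (fun p ↦ ¬ win p)).card : ℝ) ≤ C₃ * T := by
    have hA : ((S ×ˢ S).filter close).filter (fun p ↦ ¬ win p) ⊆ S ×ˢ S :=
      (Finset.filter_subset _ _).trans (Finset.filter_subset _ _)
    have hcl : ∀ p ∈ ((S ×ˢ S).filter close).filter (fun p ↦ ¬ win p),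
        |zetaOrdinate p.1 - zetaOrdinate p.2| ≤ 1 := by
      intro p hp
      simp only [Finset.mem_filter, hclose] at hp
      obtain ⟨⟨-, hc1, hc2⟩, -⟩ := hp
      have hq : 2 * π * (δ / 4) / Real.log T ≤ 1 := by
        rw [div_le_iff₀ hlogpos]; linarith
      rw [abs_le]
      constructor
      · have : 2 * π * -(δ / 4) / Real.log T = -(2 * π * (δ / 4) / Real.log T) := by ring
        linarith
      · linarith
    have hoff : ∀ p ∈ ((S ×ˢ S).filter close).filter (fun p ↦ ¬ win p),
        zetaOrdinate p.1 ≤ L ∨ zetaOrdinate p.2 ≤ L := by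
      intro p hp
      simp only [Finset.mem_filter, hwin, not_and_or, not_lt] at hp
      exact hp.2
    have hb := AH.card_pairs_offWindow_le hC₀.le hW hTpos.le hA hcl hoff
    -- `N(L+1) ≤ CN (L+1) log(L+1) ≤ CN · (2L) · log T`, `log (T+4) ≤ 2 log T`
    have hNL : (zetaZeroCount (L + 1) : ℝ) ≤ CN * ((L + 1) * Real.log (L + 1)) :=
      hN (L + 1) (by linarith)
    have hlogL : Real.log (L + 1) ≤ Real.log T := Real.log_le_log (by linarith) hL1T
    have hlogT4 : Real.log (T + 4) ≤ 2 * Real.log T := by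
      rw [show 2 * Real.log T = Real.log (T ^ 2) by rw [Real.log_pow]; norm_num]
      exact Real.log_le_log (by linarith) (by nlinarith)
    have hLT : (L + 1) * Real.log T ^ 2 ≤ 2 * T := by
      have : L * Real.log T ^ 2 = T := by
        rw [hL]; field_simp
      nlinarith [sq_nonneg (Real.log T)]
    have hlogL0 : 0 ≤ Real.log (L + 1) := Real.log_nonneg (by linarith)
    have hlog4 : 0 ≤ Real.log (T + 4) := Real.log_nonneg (by linarith)
    have hT4 : 0 ≤ 3 * C₀ * Real.log (T + 4) := by positivity
    have hNL0 : 0 ≤ CN * ((L + 1) * Real.log (L + 1)) :=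
      mul_nonneg hCN.le (mul_nonneg (by linarith) hlogL0)
    calc ((((S ×ˢ S).filter close).filter (fun p ↦ ¬ win p)).card : ℝ)
        ≤ zetaZeroCount (L + 1) * (3 * C₀ * Real.log (T + 4)) := hb
      _ ≤ CN * ((L + 1) * Real.log (L + 1)) * (3 * C₀ * (2 * Real.log T)) :=
          mul_le_mul hNL (by gcongr) hT4 hNL0
      _ ≤ CN * ((L + 1) * Real.log T) * (3 * C₀ * (2 * Real.log T)) := by
          gcongr
      _ = 6 * CN * C₀ * ((L + 1) * Real.log T ^ 2) := by ring
      _ ≤ 6 * CN * C₀ * (2 * T) := by gcongr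
      _ = C₃ * T := by rw [hC₃]; ring
  -- (III) assemble
  have hNT : T / (2 * π) * Real.log T - C₂ * T ≤ (zetaZeroCount T : ℝ) := hlow T hT2
  have hmain : AH.binDensity 0 T (δ / 2) δ * (T / (2 * π) * Real.log T) ≤
      (1 + ε / 2) * (T / (2 * π) * Real.log T) := by
    gcongr
  have hkey : C₃ * T + (1 + ε) * C₂ * T ≤ ε / 2 * (T / (2 * π) * Real.log T) := by
    -- from `h5`: `4π (C₃ + (1+ε) C₂)/ε ≤ log T`
    have h5' := (div_le_iff₀ hε).mp h5
    have hq : C₃ + (1 + ε) * C₂ ≤ ε * Real.log T / (4 * π) := by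
      rw [le_div_iff₀ (by positivity)]
      linarith
    calc C₃ * T + (1 + ε) * C₂ * T = (C₃ + (1 + ε) * C₂) * T := by ring
      _ ≤ ε * Real.log T / (4 * π) * T := mul_le_mul_of_nonneg_right hq hTpos.le
      _ = ε / 2 * (T / (2 * π) * Real.log T) := by ring
  have hNT' : (1 + ε) * (T / (2 * π) * Real.log T - C₂ * T) ≤ (1 + ε) * (zetaZeroCount T : ℝ) :=
    mul_le_mul_of_nonneg_left hNT (by linarith)
  rw [hcount]
  linarith

/-- **BGSTB 2025, Theorem 2, full printed conclusion** modulo the claim: `bgstb2025_theorem2` (RH and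
Strong AH-Pairs give `p_0 = 1`) yields the Essential Simplicity Hypothesis ("… `= 1`, and thus the
Essential Simplicity Hypothesis is true"), by `essentialSimplicity_of_hasLimitingDensity_one` at the
bin half-width `δ = 1/2`. [claim: BaluyotGoldstonSuriajayaTurnageButterbaugh2025, status: under-review] -/
theorem essentialSimplicity_of_theorem2 (h : bgstb2025_theorem2) (hRH : RiemannHypothesis)
    (hS : StrongAHPairs) : EssentialSimplicityHypothesis :=
  essentialSimplicity_of_hasLimitingDensity_one (δ := 1 / 2) (by norm_num)
    (h hRH hS (1 / 2) (by norm_num) le_rfl)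

end Literature.NumberTheory.LFunctions

end
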